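import Summits.Schanuel.Schanuel.Theorems.RootDecomp1KXLinearII02

/-!
# RootDecomp1KXLinearII — lens 1, generation 45, node 3 (g45c) «THE OTHER PLACE AT ∞: ALL x-LINEAR CURVES A(Y) + x·B(Y) WITH B SEPARABLE OVER ℚ, ANY DEGREES, EVERY m₀ ≥ 3» (RULE K-R33 (ii); CLAIM L2288, ACK/CHECKLIST K-g45c L2290 = PRICE THEOREM ×1, NODE L2299; critic VERDICT pending at staging — filed only on GO and only once Literature RidoutRationalsZero builds on the farm) — continuation (RootDecomp1KXLinearII03): §XII part 3 — levels finite, the headlines thinFibreAt_xLinear_sep / _of_sep, instances, the consumer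

(lens-1 g45c HOME kernel K₃ = HOME/decomp-schanuel-lens-1/g45c/DLxlinear2.lean ce89a773… 4482 l = K₂ (tree: DegreeLadder01–09 + XLinear01–05) + §XII xii_tail.lean 644 l (ns `…RootDecomp1KXLinearII`). Port by census-1 gen 19 as `RootDecomp1KXLinearII01–03` importing tree XLinear05 + Literature RidoutRationalsZero: 01 = the Diophantine input fed BY TREE NAME (`ridout_one (Q) …` with `Ridout.finite_of_abs_le_one` at S = {2}, κ = 5/2; `ridout_window`), `norm_psNumer`, `norm_aeval_le`, `roots_data`; 02 = NEAREST ROOT `nearest_root`, `caseII_close`, `dichotomy_arith`; 03 = `levels_finite_of_B_ne`, `thinFibreAt_xLinear_sep (A B) (hsep : (B.map (Int.castRingHom ℚ)).Separable) (hle : A.natDegree ≤ B.natDegree) (hm : 3 ≤ m₀) : ThinFibreAt m₀ (xLinP A B)` (scoped `maxHeartbeats 400000` as in K), the UNION `thinFibreAt_xLinear_of_sep` (any degrees; case split with the tree's `thinFibreAt_xLinear_of_lt`), instances `thinFibreAt_lineP` (m₀ ≥ 3), `thinFibreAt_fermatTwist`, the consumer `xLinearSep_nonvanishing (hm : 3 ≤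 m) (hρ : SkelLiouvilleFix m ρ) (A B) (hsep) : aeval ρ A + liouvilleNumber 2 * aeval ρ B ≠ 0` — ALL HYPOTHESIS-FREE.
PORT EDITS: the `def PadicRothRat` DELETED and the `(hR : PadicRothRat)` binder REMOVED from the seven decls that carried it, `Literature.NumberTheory.DiophantineApproximation.Ridout.finite_of_abs_le_one` fed directly at the one use site in `ridout_one` (same shape as DegreeLadder09 / XLinear01, critic L2282 (b)/(d)); node-2 primed names re-pointed to the tree's unprimed binder-free forms (`thinFibreAt_xLinear_of_lt`, `xLinear_nonvanishing`); `open …XLinearCore (norm_two …)` ↦ unrestricted open + private copies (those Core lemmas are private in the tree port); linter option dropped; two docstrings added; two generic helpers private; statements and proofs otherwise verbatim. `--supports stmt-Schanuel-33364`; no census credit; rung 0.)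
-/

noncomputable section

namespace Summit.Schanuel.Schanuel.Theorems.RootDecomp1KXLinearII

open Polynomial LiouvilleNumber
open scoped Nat
open Summit.Schanuel.Schanuel.Theorems.RootDecomp1KSkelCell
  (exists_le_two_pow_factorial iota iota_spec iota_le_of_le pow_lt_of_lt_iota lt_iota_of_pow_lt iota_mono
   one_le_iota SkelLiouville SkelLiouvilleFix skelLiouville_iff_fix SkelLiouvilleFix.mono uStar dU rU dU_cast
   two_pow_le_four_mul_dU two_mul_dU_lt one_le_dU rU_den rU_cast uStar_sub_rU skelLiouvilleFix_one_uStar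
   not_skelFixOne_algebraicIndependent)
open Summit.Schanuel.Schanuel.Theorems.RootDecomp1KTwoBaseCell (psNumer partialSum_eq_psNumer_div coprime_psNumer
  algebraicIndependent_of_forall_int')
open Summit.Schanuel.Schanuel.Theorems.RootDecomp1KRelLiouvilleCell (partialSum_two_strictMono
  partialSum_two_lt_liouvilleNumber abs_liouvilleNumber_two_sub_partialSum)
open Summit.Schanuel.Schanuel.Theorems.RootDecomp1KDegreeLadder
open Summit.Schanuel.Schanuel.Theorems.RootDecomp1KXLinearCore
open Summit.Schanuel.Schanuel.Theorems.RootDecomp1KXLinear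

/-- `s_N = p_N / 2^{N!}` (tree `partialSum_eq_psNumer_div` at `b = 2`). -/
private theorem partialSum_two (N : ℕ) : partialSum 2 N = (psNumer 2 N : ℝ) / (2 : ℝ) ^ N ! := by
  have := partialSum_eq_psNumer_div (b := 2) (by norm_num) N
  simpa using this

/-- A non-degenerate point has `B(r) ≠ 0` (else `P(x, r) = A(r)` for all `x`, and `A(r) = 0` from the level). -/
theorem aeval_B_ne_zero_of_nondeg {A B : ℤ[X]} {x₀ : ℝ} {r : ℚ} (hP : bev (xLinP A B) x₀ r = 0)
    (hnd : ∃ x : ℝ, bev (xLinP A B) x r ≠ 0) : aeval r B ≠ 0 := by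
  intro h0
  have hB : aeval (r : ℝ) B = 0 := by rw [← aeval_ratCast, h0, Rat.cast_zero]
  obtain ⟨x, hx⟩ := hnd
  rw [bev_xLinP, hB, mul_zero, add_zero] at hx hP
  exact hx hP

/-- A point `r` with `B(r) ≠ 0` lies on at most one level (`x = −A(r)/B(r)` and `N ↦ s_N` is injective). -/
theorem levels_finite_of_B_ne {A B : ℤ[X]} {r : ℚ} (hBr : aeval r B ≠ 0) : {N : ℕ | OnLevel A B N r}.Finite := by
  apply Set.Subsingleton.finite
  intro N hN N' hN'
  have h1 : (psNumer 2 N : ℚ) / 2 ^ N ! = (psNumer 2 N' : ℚ) / 2 ^ N' ! := by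
    have e1 : aeval r A + (psNumer 2 N : ℚ) / 2 ^ N ! * aeval r B = 0 := hN
    have e2 : aeval r A + (psNumer 2 N' : ℚ) / 2 ^ N' ! * aeval r B = 0 := hN'
    have : (psNumer 2 N : ℚ) / 2 ^ N ! * aeval r B = (psNumer 2 N' : ℚ) / 2 ^ N' ! * aeval r B := by
      linarith
    exact mul_right_cancel₀ hBr this
  have h2 : partialSum 2 N = partialSum 2 N' := by
    rw [partialSum_two, partialSum_two]
    have := congrArg (Rat.cast : ℚ → ℝ) h1
    push_cast at this
    exact this
  exact partialSum_two_strictMono.injective h2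

/-- The degenerate bottom `A, B` constant (`B = b₀ ≠ 0`): `P = a₀ + b₀·x` has points on at most one level. -/
theorem thinFibreAt_xLinear_const (A B : ℤ[X]) (hB : B ≠ 0) (hb : B.natDegree = 0) (ha : A.natDegree = 0)
    (m₀ : ℕ) : ThinFibreAt m₀ (xLinP A B) := by
  have hA : A = Polynomial.C (A.coeff 0) := eq_C_of_natDegree_eq_zero ha
  have hBC : B = Polynomial.C (B.coeff 0) := eq_C_of_natDegree_eq_zero hb
  have hb0 : ((B.coeff 0 : ℤ) : ℝ) ≠ 0 := by
    have : B.coeff 0 ≠ 0 := by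
      intro h; apply hB; rw [hBC, h, map_zero]
    exact_mod_cast this
  have hbev : ∀ x y : ℝ, bev (xLinP A B) x y = (A.coeff 0 : ℝ) + x * (B.coeff 0 : ℝ) := by
    intro x y
    rw [bev_xLinP]
    conv_lhs => rw [hA, hBC]
    rw [aeval_C, aeval_C, algebraMap_int_eq, eq_intCast, eq_intCast]
  intro C
  by_cases hex : ∃ N₁ : ℕ, (A.coeff 0 : ℝ) + partialSum 2 N₁ * (B.coeff 0 : ℝ) = 0
  · obtain ⟨N₁, hN₁⟩ := hex
    refine ⟨N₁ + 1, fun N hN r _ hP _ => ?_⟩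
    exfalso
    rw [hbev] at hP
    have h1 : partialSum 2 N * (B.coeff 0 : ℝ) = partialSum 2 N₁ * (B.coeff 0 : ℝ) := by linarith
    have h2 : partialSum 2 N = partialSum 2 N₁ := mul_right_cancel₀ hb0 h1
    have := partialSum_two_strictMono.injective h2
    omega
  · refine ⟨0, fun N _ r _ hP _ => ?_⟩
    exfalso
    rw [hbev] at hP
    exact hex ⟨N, hP⟩

/-- A polynomial whose image over `ℚ` is separable is non-zero. -/
private theorem ne_zero_of_map_separable {B : ℤ[X]} (hsep : (B.map (Int.castRingHom ℚ)).Separable) : B ≠ 0 := by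
  rintro rfl
  rw [Polynomial.map_zero] at hsep
  exact not_separable_zero hsep

set_option maxHeartbeats 400000 in
/-- **THE x-LINEAR THIN FIBRE AT THE OTHER PLACE** (`deg A ≤ deg B`, `B` separable over `ℚ`): `ThinFibreAt m₀`
for EVERY `m₀ ≥ 3`, HYPOTHESIS-FREE at port: Ridout's theorem for rationals is the tree's `Ridout.finite_of_abs_le_one`, applied by name. -/
theorem thinFibreAt_xLinear_sep (A B : ℤ[X]) (hsep : (B.map (Int.castRingHom ℚ)).Separable)
    (hle : A.natDegree ≤ B.natDegree) {m₀ : ℕ} (hm : 3 ≤ m₀) : ThinFibreAt m₀ (xLinP A B) := by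
  classical
  have hB : B ≠ 0 := ne_zero_of_map_separable hsep
  by_cases hb : 1 ≤ B.natDegree
  swap
  · exact thinFibreAt_xLinear_const A B hB (by omega) (by omega) m₀
  intro C
  obtain ⟨T, c, N₁, hc, hTroots, hclose⟩ := caseII_close A B hb hsep hle
  obtain ⟨N₂, hN₂⟩ := dichotomy_arith c C
  have hF := ridout_window B hb C
  have hbad : (⋃ r ∈ {r : ℚ | |(r : ℝ)| ≤ C ∧ ∃ β : PadicAlgCl 2, aeval β B = 0 ∧
      (r.den : ℝ) ^ 5 * ‖(B.leadingCoeff : PadicAlgCl 2) * ((r : PadicAlgCl 2) - β)‖ ^ 2 ≤ 1},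
      {N : ℕ | aeval r B ≠ 0 ∧ OnLevel A B N r}).Finite := by
    refine hF.biUnion fun r _ => ?_
    by_cases hBr : aeval r B = 0
    · exact Set.finite_empty.subset fun N hN => (hN.1 hBr).elim
    · exact (levels_finite_of_B_ne hBr).subset fun N hN => hN.2
  obtain ⟨N₃, hN₃⟩ := hbad.bddAbove
  refine ⟨max (max N₁ N₂) (N₃ + 1), fun N hN r hr hP hnd => ?_⟩
  have hNN₁ : N₁ ≤ N := le_trans (le_trans (le_max_left _ _) (le_max_left _ _)) hN
  have hNN₂ : N₂ ≤ N := le_trans (le_trans (le_max_right _ _) (le_max_left _ _)) hN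
  have hNN₃ : N₃ + 1 ≤ N := le_trans (le_max_right _ _) hN
  have hpt : OnLevel A B N r := onLevel_of_bev hP
  have hBr : aeval r B ≠ 0 := aeval_B_ne_zero_of_nondeg hP hnd
  obtain ⟨β, hβT, hx⟩ := hclose N hNN₁ r hpt hBr
  have hnot : ¬ ((r.den : ℝ) ^ 5 * ‖(B.leadingCoeff : PadicAlgCl 2) * ((r : PadicAlgCl 2) - β)‖ ^ 2 ≤ 1) := by
    intro hineq
    have hmem : N ∈ ⋃ r ∈ {r : ℚ | |(r : ℝ)| ≤ C ∧ ∃ β : PadicAlgCl 2, aeval β B = 0 ∧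
        (r.den : ℝ) ^ 5 * ‖(B.leadingCoeff : PadicAlgCl 2) * ((r : PadicAlgCl 2) - β)‖ ^ 2 ≤ 1},
        {N : ℕ | aeval r B ≠ 0 ∧ OnLevel A B N r} :=
      Set.mem_biUnion (x := r) ⟨hr, β, hTroots β hβT, hineq⟩ ⟨hBr, hpt⟩
    have := hN₃ hmem
    omega
  have h3 := hN₂ N hNN₂ r.den _ (Nat.succ_le_of_lt r.den_pos) (norm_nonneg _) hx hnot
  have hd1 : (1 : ℝ) ≤ r.den := by exact_mod_cast Nat.succ_le_of_lt r.den_pos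
  exact h3.trans_le (pow_le_pow_right₀ hd1 (Nat.mul_le_mul_right _ hm))

/-- **ALL x-LINEAR CURVES WITH `B` SEPARABLE, ANY DEGREES, EVERY `m₀ ≥ 3`** (union with node 2's `deg B < deg A`,
which is hypothesis-free). -/
theorem thinFibreAt_xLinear_of_sep (A B : ℤ[X]) (hsep : (B.map (Int.castRingHom ℚ)).Separable)
    {m₀ : ℕ} (hm : 3 ≤ m₀) : ThinFibreAt m₀ (xLinP A B) := by
  rcases Nat.lt_or_ge B.natDegree A.natDegree with hlt | hle
  · exact thinFibreAt_xLinear_of_lt A B (ne_zero_of_map_separable hsep) hlt (by omega)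
  · exact thinFibreAt_xLinear_sep A B hsep hle hm

/-! ### Position -/

/-- node 1's line `(x − 1)·Y = 1` (= `xLinP (−Y − 1) Y`, gap `0`, outside node 2's classes) IS in the class:
`ThinFibreAt m₀ lineP` for every `m₀ ≥ 3` — consistent with `not_thinFibre_one` (which is `m₀ = 1`, witnessed by
this very line); `m₀ = 2` for the line is not decided HERE — it IS decided by the degree ladder
(`RootDecomp1KLevelFinite.thinFibreAt_two_lineP`, `natDegree lineP ≤ 1 < 2`, `RootDecomp1KLevelFinite13`); erratum of
record (crit L2522 / census C196): the earlier wording «(Roth-critical, open)» was wrong. -/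
theorem thinFibreAt_lineP {m₀ : ℕ} (hm : 3 ≤ m₀) : ThinFibreAt m₀ lineP := by
  rw [lineP_eq_xLinP]
  refine thinFibreAt_xLinear_of_sep _ _ ?_ hm
  rw [Polynomial.map_X]; exact separable_X

/-- bottom members beyond node 2: the Fermat twists `1 + x·(Y^b − 1)`, `b ≥ 1` (`deg A = 0 < b = deg B`). -/
theorem thinFibreAt_fermatTwist (b : ℕ) (hb : 1 ≤ b) {m₀ : ℕ} (hm : 3 ≤ m₀) :
    ThinFibreAt m₀ (xLinP 1 (X ^ b - 1)) := by
  refine thinFibreAt_xLinear_of_sep _ _ ?_ hm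
  rw [Polynomial.map_sub, Polynomial.map_pow, Polynomial.map_X, Polynomial.map_one]
  have h := separable_X_pow_sub_C (1 : ℚ) (show (b : ℚ) ≠ 0 by exact_mod_cast (by omega : b ≠ 0)) one_ne_zero
  simpa using h

/-! ### Consumer -/

/-- `deg_Y (xLinP A B) ≥ deg B`. -/
theorem natDegree_xLinP_ge_right (A B : ℤ[X]) (hB : B ≠ 0) : B.natDegree ≤ (xLinP A B).natDegree := by
  apply le_natDegree_of_ne_zero
  rw [coeff_xLinP]
  intro h
  have h0 := congrArg (Polynomial.eval 0) h
  have h1 := congrArg (Polynomial.eval 1) h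
  simp only [eval_add, eval_C, eval_mul, eval_X, zero_mul, add_zero, one_mul, eval_zero] at h0 h1
  have h2 : B.coeff B.natDegree = 0 := by linarith
  exact leadingCoeff_ne_zero.mpr hB h2

/-- **CONSUMER**: for `ρ ∈ Skel₍m₎`, `m ≥ 3`, and all `A, B ∈ ℤ[Y]` with `B` separable over `ℚ` (any degrees):
`A(ρ) + ℓ₂·B(ρ) ≠ 0`. -/
theorem xLinearSep_nonvanishing {m : ℕ} (hm : 3 ≤ m) {ρ : ℝ} (hρ : SkelLiouvilleFix m ρ)
    (A B : ℤ[X]) (hsep : (B.map (Int.castRingHom ℚ)).Separable) :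
    aeval ρ A + liouvilleNumber 2 * aeval ρ B ≠ 0 := by
  have hB : B ≠ 0 := ne_zero_of_map_separable hsep
  rcases Nat.lt_or_ge B.natDegree A.natDegree with hlt | hle
  · exact xLinear_nonvanishing (by omega) hρ A B hB hlt
  by_cases hb : 1 ≤ B.natDegree
  · intro hzero
    have hroot : bev (xLinP A B) (liouvilleNumber 2) ρ = 0 := by rw [bev_xLinP]; exact hzero
    have hBρ : aeval ρ B ≠ 0 := fun h => hρ.transcendental (by omega) ⟨B, hB, h⟩
    have hτ : bev (dX (xLinP A B)) (liouvilleNumber 2) ρ ≠ 0 := by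
      rw [dX_xLinP, bev_map_C]; exact hBρ
    have hd : 1 ≤ (xLinP A B).natDegree := hb.trans (natDegree_xLinP_ge_right A B hB)
    exact (engine_of_clause (by omega) hd hroot hτ hρ (thinFibreAt_xLinear_sep A B hsep hle hm)).elim
  · -- `A = a₀`, `B = b₀ ≠ 0`: `a₀ + ℓ₂ b₀ ≠ 0` by the irrationality of `ℓ₂`
    have hA : A = Polynomial.C (A.coeff 0) := eq_C_of_natDegree_eq_zero (by omega)
    have hBC : B = Polynomial.C (B.coeff 0) := eq_C_of_natDegree_eq_zero (by omega)
    have hb0 : B.coeff 0 ≠ 0 := by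
      intro h; apply hB; rw [hBC, h, map_zero]
    rw [hA, hBC, aeval_C, aeval_C, algebraMap_int_eq, eq_intCast, eq_intCast]
    intro h0
    have hirr : Irrational (liouvilleNumber 2) :=
      (liouville_liouvilleNumber (by norm_num : 1 < (2 : ℕ))).irrational
    apply hirr
    refine ⟨-(A.coeff 0 : ℚ) / (B.coeff 0 : ℚ), ?_⟩
    have hβR : ((B.coeff 0 : ℤ) : ℝ) ≠ 0 := by exact_mod_cast hb0
    push_cast
    field_simp
    linarith [h0]

end Summit.Schanuel.Schanuel.Theorems.RootDecomp1KXLinearII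

end
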